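import Summits.BirchSwinnertonDyer.BirchSwinnertonDyer.Theorems.ErratumRoadFiveEulerHalfNotRamInertUpToOne
import HarnessLib

/-!
# Route `ErratumRoadFive` (K2, `p ≥ 5`), crux `EulerHalfNotRamNoInertSetAtFive` (item stmt-BirchSwinnertonDyer-19715), line `birth`:
# THE DATUM LEMMA — with at most TWO offending split carriers other than `p`, an inert set `{p, q}` with the Papikian–Rabinoff half `R = {p}`
# is admissible, or admissible UP TO ONE exempted carrier (pure bookkeeping; no Heegner point, no L-function)
# (cell `bsd-stepL`, lead seat `bsd-line-er5-p1` g0; `--supports stmt-BirchSwinnertonDyer-19715 --as helper`)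

WHAT. Skeleton v6 of line `birth` leaves as its only OPEN (non-print, non-(B6)) stub the residual S2c `stub_res_otherMultNoUpToOneAtFive`: X11b ∧
`p ≥ 5` ∧ surj ∧ ¬(ram) ∧ `p ∣ ∏c` pairs with a multiplicative prime `≠ p`, NO split-set datum, NO inert-set datum (the crux's own hypothesis) and NO
«up-to-one» inert datum. THIS FILE pins that residual to an EXPLICIT thin shape by elementary bookkeeping: the multiplicative BSD prime `p ≥ 5` may
itself sit in the Papikian–Rabinoff half (`p ≠ 2`, `p ∤ p − 1`), so the two-element inert set `S = {p, q}` with `R = {p}` is admissible as soon as at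
most ONE offending split carrier `≠ p` lies outside it — hence:
* `inertDatum_or_upToOneDatum_of_not_threeOffending` — for `W` multiplicative at a prime `p ≥ 5` with some multiplicative prime `≠ p`: UNLESS there
  are THREE distinct split multiplicative primes `q₁, q₂, q₃ ≠ p` with `p ∣ ord_{q_i} Δ_min` («offending carriers»), EITHER an inert-set datum in the
  crux's own currency (`S ∋ p` even multiplicative, every split `ℓ ∉ S` non-offending, half `R ⊆ S` of primes `q ≠ 2`, `p ∤ q − 1`) — which the crux
  19715 EXCLUDES by hypothesis — OR the up-to-one datum of the lead's road p616118 (`S ∋ p`, one offending split `q₁ ∉ S` exempted, same half).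
  Cases: no offending carrier `≠ p` → `S = {p, x}` for any multiplicative `x ≠ p`; one, `q` → `S = {p, q}`; two, `q ≠ q'` → `S = {p, q}`, exempt `q'`.
* `res_otherMultNoUpToOneAtFive_of_threeOffending` — CONSEQUENTLY the v6 residual S2c follows from its restriction to pairs WITH three distinct
  offending split carriers `≠ p` (the v7 residual `stub_res_otherMultThreeOffendingAtFive`, statement displayed as the hypothesis `hC3`): the
  honest open content of crux 19715 along line `birth` is the «three offending carriers» shape (cf. 19065 hybrid r7's `stub_threeSplit57`), 0 census
  pairs below `5·10⁵`, barrier `StringentKolyvaginCapsAtMax` (two Jetchev savings = a sum, not a max).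

HONEST FRAMING: THEOREMS ONLY (bookkeeping on finite sets of primes), Theses-free, no `sorry`, no definition, no named fact; nothing about any L-value,
Selmer group or Heegner point is proved; nothing is booked; 19715 is NOT closed; BSD is proved for no curve; no summit statement is touched.
References (locators only): [cite: PastenShimura2024, §6.6, Lemma 6.18 (the pairing half; `q = p` allowed since `p ∤ p − 1`)] [cite: PapikianRabinoff2016, Cor. 3.5]
[cite: Jetchev2008, Thm. 1.1, Cor. 1.5].
-/

set_option autoImplicit false
set_option linter.dupNamespace false

noncomputable section

open scoped Classical

open WeierstrassCurve Literature.NumberTheory.EllipticCurves.Rank1Residual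
  Literature.NumberTheory.EllipticCurves.Rank1Residual.Typed Summit.BirchSwinnertonDyer.Rank1Residual

namespace Summit.BirchSwinnertonDyer.BirchSwinnertonDyer.Theorems.EulerHalfInertUpToOne

/-! ### §1 The datum lemma -/

/-- **At most two offending split carriers `≠ p` ⟹ an inert-set datum `{p, q}` with half `{p}`, or the same up to ONE exempted carrier.**
`W` multiplicative at the prime `p ≥ 5`, some multiplicative prime `x ≠ p`; «offending» = split multiplicative `q ≠ p` with `p ∣ ord_q Δ_min`.
Unless three distinct offending carriers exist: (no offender) `S = {p, x}`; (one, `q`) `S = {p, q}`; both with `R = {p}` — an inert-set datum in the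
crux's currency —; (two, `q ≠ q'`) `S = {p, q}`, `R = {p}`, `q'` exempted — the up-to-one datum. Bookkeeping only.
[cite: PastenShimura2024, Lemma 6.18] [cite: PapikianRabinoff2016, Cor. 3.5] -/
theorem inertDatum_or_upToOneDatum_of_not_threeOffending
    (W : WeierstrassCurve ℚ) [W.IsElliptic] [W.IsGloballyMinimal] (p : ℕ) [Fact p.Prime] (hp5 : 5 ≤ p) (hmult : Mult W p)
    (hother : ∃ ℓ : ℕ, ∃ _ : Fact ℓ.Prime, ℓ ≠ p ∧ W.HasMultiplicativeReductionAtPrime ℓ)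
    (h3 : ¬ ∃ (q₁ q₂ q₃ : ℕ) (_ : Fact q₁.Prime) (_ : Fact q₂.Prime) (_ : Fact q₃.Prime),
      q₁ ≠ p ∧ q₂ ≠ p ∧ q₃ ≠ p ∧ q₁ ≠ q₂ ∧ q₁ ≠ q₃ ∧ q₂ ≠ q₃ ∧
      W.HasSplitMultiplicativeReductionAtPrime q₁ ∧ p ∣ padicValInt q₁ W.minimalDiscriminantInt ∧
      W.HasSplitMultiplicativeReductionAtPrime q₂ ∧ p ∣ padicValInt q₂ W.minimalDiscriminantInt ∧
      W.HasSplitMultiplicativeReductionAtPrime q₃ ∧ p ∣ padicValInt q₃ W.minimalDiscriminantInt) :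
    (∃ S : Finset ℕ, (∀ ℓ ∈ S, ∃ _ : Fact ℓ.Prime, Mult W ℓ) ∧ Even S.card ∧ p ∈ S ∧
        (∀ (ℓ : ℕ) [Fact ℓ.Prime], ℓ ∉ S → W.HasSplitMultiplicativeReductionAtPrime ℓ →
          ¬ p ∣ padicValInt ℓ W.minimalDiscriminantInt) ∧
        (¬ p ∣ padicValInt p W.minimalDiscriminantInt ∨
          ∃ R ⊆ S, S.card = 2 * R.card ∧ ∀ q ∈ R, q ≠ 2 ∧ ¬ p ∣ q - 1)) ∨
      (∃ (q₁ : ℕ) (_ : Fact q₁.Prime) (S : Finset ℕ), W.HasSplitMultiplicativeReductionAtPrime q₁ ∧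
        p ∣ padicValInt q₁ W.minimalDiscriminantInt ∧
        (∀ ℓ ∈ S, ∃ _ : Fact ℓ.Prime, Mult W ℓ) ∧ Even S.card ∧ p ∈ S ∧ q₁ ∉ S ∧
        (∀ (ℓ : ℕ) [Fact ℓ.Prime], ℓ ∉ S → ℓ ≠ q₁ → W.HasSplitMultiplicativeReductionAtPrime ℓ →
          ¬ p ∣ padicValInt ℓ W.minimalDiscriminantInt) ∧
        ∃ R ⊆ S, S.card = 2 * R.card ∧ ∀ q ∈ R, q ≠ 2 ∧ ¬ p ∣ q - 1) := by
  have hp := (Fact.out : p.Prime)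
  -- the half `R = {p}` of any `S = {p, x}`: `p ≠ 2`, `p ∤ p − 1`
  have hp2 : p ≠ 2 := by omega
  have hpp : ¬ p ∣ p - 1 := fun h ↦ by
    have := Nat.le_of_dvd (by omega) h
    omega
  have hpair : ∀ x : ℕ, x ≠ p → ({p, x} : Finset ℕ).card = 2 * ({p} : Finset ℕ).card := by
    intro x hx
    rw [Finset.card_pair (Ne.symm hx), Finset.card_singleton]
  have hR : ∀ x : ℕ, x ≠ p → ∃ R ⊆ ({p, x} : Finset ℕ), ({p, x} : Finset ℕ).card = 2 * R.card ∧
      ∀ q ∈ R, q ≠ 2 ∧ ¬ p ∣ q - 1 := fun x hx ↦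
    ⟨{p}, by simp, hpair x hx, fun q hq ↦ by
      rw [Finset.mem_singleton] at hq
      subst hq
      exact ⟨hp2, hpp⟩⟩
  have heven : ∀ x : ℕ, x ≠ p → Even ({p, x} : Finset ℕ).card := fun x hx ↦ by
    rw [Finset.card_pair (Ne.symm hx)]
    exact even_two
  -- the members of `{p, x}` are multiplicative primes as soon as `x` is
  have hmem : ∀ (x : ℕ) (_ : Fact x.Prime), W.HasMultiplicativeReductionAtPrime x →
      ∀ ℓ ∈ ({p, x} : Finset ℕ), ∃ _ : Fact ℓ.Prime, Mult W ℓ := by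
    intro x hxp hxm ℓ hℓ
    rcases Finset.mem_insert.mp hℓ with rfl | hℓ
    · exact ⟨inferInstance, hmult⟩
    · rw [Finset.mem_singleton] at hℓ
      subst hℓ
      exact ⟨hxp, hxm⟩
  -- «offending carrier other than p»
  set Off : ℕ → Prop := fun q ↦ ∃ _ : Fact q.Prime, q ≠ p ∧ W.HasSplitMultiplicativeReductionAtPrime q ∧
    p ∣ padicValInt q W.minimalDiscriminantInt with hOff
  by_cases h0 : ∃ q, Off q
  · obtain ⟨q, hqF, hqp, hqs, hqd⟩ := h0
    by_cases h1 : ∃ q', Off q' ∧ q' ≠ q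
    · obtain ⟨q', ⟨hq'F, hq'p, hq's, hq'd⟩, hq'q⟩ := h1
      by_cases h2 : ∃ q'', Off q'' ∧ q'' ≠ q ∧ q'' ≠ q'
      · obtain ⟨q'', ⟨hq''F, hq''p, hq''s, hq''d⟩, hq''q, hq''q'⟩ := h2
        exact absurd ⟨q, q', q'', hqF, hq'F, hq''F, hqp, hq'p, hq''p, Ne.symm hq'q, Ne.symm hq''q, Ne.symm hq''q',
          hqs, hqd, hq's, hq'd, hq''s, hq''d⟩ h3
      · -- exactly two offenders `q ≠ q'`: `S = {p, q}`, exempt `q'`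
        refine Or.inr ⟨q', hq'F, {p, q}, hq's, hq'd, hmem q hqF hqs.hasMultiplicativeReductionAtPrime, heven q hqp,
          by simp, ?_, ?_, hR q hqp⟩
        · simp only [Finset.mem_insert, Finset.mem_singleton, not_or]
          exact ⟨hq'p, hq'q⟩
        · intro ℓ _ hℓS hℓq' hℓs hℓd
          simp only [Finset.mem_insert, Finset.mem_singleton, not_or] at hℓS
          exact h2 ⟨ℓ, ⟨inferInstance, hℓS.1, hℓs, hℓd⟩, hℓS.2, hℓq'⟩
    · -- exactly one offender `q`: `S = {p, q}`
      refine Or.inl ⟨{p, q}, hmem q hqF hqs.hasMultiplicativeReductionAtPrime, heven q hqp, by simp, ?_, Or.inr (hR q hqp)⟩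
      intro ℓ _ hℓS hℓs hℓd
      simp only [Finset.mem_insert, Finset.mem_singleton, not_or] at hℓS
      exact h1 ⟨ℓ, ⟨inferInstance, hℓS.1, hℓs, hℓd⟩, hℓS.2⟩
  · -- no offender other than `p`: `S = {p, x}` for any multiplicative `x ≠ p`
    obtain ⟨x, hxF, hxp, hxm⟩ := hother
    refine Or.inl ⟨{p, x}, hmem x hxF hxm, heven x hxp, by simp, ?_, Or.inr (hR x hxp)⟩
    intro ℓ _ hℓS hℓs hℓd
    simp only [Finset.mem_insert, Finset.mem_singleton, not_or] at hℓS
    exact h0 ⟨ℓ, inferInstance, hℓS.1, hℓs, hℓd⟩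

/-! ### §2 The v6 residual S2c from the «three offending carriers» residual -/

/-- **S2c of line `birth` v6 (`stub_res_otherMultNoUpToOneAtFive`, its statement VERBATIM as conclusion) from its restriction to pairs with THREE
distinct offending split carriers `≠ p`** (the v7 residual, displayed as the hypothesis `hC3`): by §1, a pair without three offenders has an inert-set
datum (excluded by the crux's hypothesis) or the up-to-one datum (excluded by S2c's last hypothesis). Bookkeeping only; CONDITIONAL on `hC3`.
[cite: PastenShimura2024, Lemma 6.18] -/
theorem res_otherMultNoUpToOneAtFive_of_threeOffending
    (hC3 : ∀ (W : WeierstrassCurve ℚ) [W.IsElliptic] [W.IsGloballyMinimal] (p : ℕ) [Fact p.Prime],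
      ClassX11b W p → 5 ≤ p → Surj W p → ¬ Ram W p → p ∣ W.tamagawaProduct →
      (∃ (q₁ q₂ q₃ : ℕ) (_ : Fact q₁.Prime) (_ : Fact q₂.Prime) (_ : Fact q₃.Prime),
        q₁ ≠ p ∧ q₂ ≠ p ∧ q₃ ≠ p ∧ q₁ ≠ q₂ ∧ q₁ ≠ q₃ ∧ q₂ ≠ q₃ ∧
        W.HasSplitMultiplicativeReductionAtPrime q₁ ∧ p ∣ padicValInt q₁ W.minimalDiscriminantInt ∧
        W.HasSplitMultiplicativeReductionAtPrime q₂ ∧ p ∣ padicValInt q₂ W.minimalDiscriminantInt ∧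
        W.HasSplitMultiplicativeReductionAtPrime q₃ ∧ p ∣ padicValInt q₃ W.minimalDiscriminantInt) →
      ¬ (∃ S : Finset ℕ, (∀ ℓ ∈ S, ∃ _ : Fact ℓ.Prime, Mult W ℓ) ∧ Even S.card ∧ p ∈ S ∧
        (∀ (ℓ : ℕ) [Fact ℓ.Prime], ℓ ∉ S → W.HasSplitMultiplicativeReductionAtPrime ℓ → ¬ p ∣ padicValInt ℓ W.minimalDiscriminantInt) ∧
        (¬ p ∣ padicValInt p W.minimalDiscriminantInt ∨ ∃ R ⊆ S, S.card = 2 * R.card ∧ ∀ q ∈ R, q ≠ 2 ∧ ¬ p ∣ q - 1)) →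
      ¬ (∃ S : Finset ℕ, (∀ ℓ ∈ S, ∃ _ : Fact ℓ.Prime, Mult W ℓ) ∧ Even S.card ∧ p ∉ S ∧
        (∀ (ℓ : ℕ) [Fact ℓ.Prime], ℓ ∉ S → W.HasSplitMultiplicativeReductionAtPrime ℓ → ¬ p ∣ padicValInt ℓ W.minimalDiscriminantInt) ∧
        ((∃ (ℓ₀ : ℕ) (_ : Fact ℓ₀.Prime), Mult W ℓ₀ ∧ ℓ₀ ≠ p ∧ ¬ p ∣ padicValInt ℓ₀ W.minimalDiscriminantInt) ∨
          ∃ R ⊆ S, S.card = 2 * R.card ∧ ∀ q ∈ R, ¬ p ∣ q - 1)) →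
      ¬ (∃ (q₁ : ℕ) (_ : Fact q₁.Prime) (S : Finset ℕ), W.HasSplitMultiplicativeReductionAtPrime q₁ ∧
        p ∣ padicValInt q₁ W.minimalDiscriminantInt ∧
        (∀ ℓ ∈ S, ∃ _ : Fact ℓ.Prime, Mult W ℓ) ∧ Even S.card ∧ p ∈ S ∧ q₁ ∉ S ∧
        (∀ (ℓ : ℕ) [Fact ℓ.Prime], ℓ ∉ S → ℓ ≠ q₁ → W.HasSplitMultiplicativeReductionAtPrime ℓ →
          ¬ p ∣ padicValInt ℓ W.minimalDiscriminantInt) ∧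
        ∃ R ⊆ S, S.card = 2 * R.card ∧ ∀ q ∈ R, q ≠ 2 ∧ ¬ p ∣ q - 1) →
      Typed.MissingUpperBoundAt W p) :
    ∀ (W : WeierstrassCurve ℚ) [W.IsElliptic] [W.IsGloballyMinimal] (p : ℕ) [Fact p.Prime], ClassX11b W p → 5 ≤ p → Surj W p → ¬ Ram W p →
      p ∣ W.tamagawaProduct → (∃ ℓ : ℕ, ∃ _ : Fact ℓ.Prime, ℓ ≠ p ∧ W.HasMultiplicativeReductionAtPrime ℓ) →
      ¬ (∃ S : Finset ℕ, (∀ ℓ ∈ S, ∃ _ : Fact ℓ.Prime, Mult W ℓ) ∧ Even S.card ∧ p ∈ S ∧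
        (∀ (ℓ : ℕ) [Fact ℓ.Prime], ℓ ∉ S → W.HasSplitMultiplicativeReductionAtPrime ℓ → ¬ p ∣ padicValInt ℓ W.minimalDiscriminantInt) ∧
        (¬ p ∣ padicValInt p W.minimalDiscriminantInt ∨ ∃ R ⊆ S, S.card = 2 * R.card ∧ ∀ q ∈ R, q ≠ 2 ∧ ¬ p ∣ q - 1)) →
      ¬ (∃ S : Finset ℕ, (∀ ℓ ∈ S, ∃ _ : Fact ℓ.Prime, Mult W ℓ) ∧ Even S.card ∧ p ∉ S ∧
        (∀ (ℓ : ℕ) [Fact ℓ.Prime], ℓ ∉ S → W.HasSplitMultiplicativeReductionAtPrime ℓ → ¬ p ∣ padicValInt ℓ W.minimalDiscriminantInt) ∧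
        ((∃ (ℓ₀ : ℕ) (_ : Fact ℓ₀.Prime), Mult W ℓ₀ ∧ ℓ₀ ≠ p ∧ ¬ p ∣ padicValInt ℓ₀ W.minimalDiscriminantInt) ∨
          ∃ R ⊆ S, S.card = 2 * R.card ∧ ∀ q ∈ R, ¬ p ∣ q - 1)) →
      ¬ (∃ (q₁ : ℕ) (_ : Fact q₁.Prime) (S : Finset ℕ), W.HasSplitMultiplicativeReductionAtPrime q₁ ∧
        p ∣ padicValInt q₁ W.minimalDiscriminantInt ∧
        (∀ ℓ ∈ S, ∃ _ : Fact ℓ.Prime, Mult W ℓ) ∧ Even S.card ∧ p ∈ S ∧ q₁ ∉ S ∧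
        (∀ (ℓ : ℕ) [Fact ℓ.Prime], ℓ ∉ S → ℓ ≠ q₁ → W.HasSplitMultiplicativeReductionAtPrime ℓ →
          ¬ p ∣ padicValInt ℓ W.minimalDiscriminantInt) ∧
        ∃ R ⊆ S, S.card = 2 * R.card ∧ ∀ q ∈ R, q ≠ 2 ∧ ¬ p ∣ q - 1) →
      Typed.MissingUpperBoundAt W p := by
  intro W _ _ p _ hX hp5 hsurj hnram htam hother hnoI hnoD hnoU
  by_cases h3 : ∃ (q₁ q₂ q₃ : ℕ) (_ : Fact q₁.Prime) (_ : Fact q₂.Prime) (_ : Fact q₃.Prime),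
      q₁ ≠ p ∧ q₂ ≠ p ∧ q₃ ≠ p ∧ q₁ ≠ q₂ ∧ q₁ ≠ q₃ ∧ q₂ ≠ q₃ ∧
      W.HasSplitMultiplicativeReductionAtPrime q₁ ∧ p ∣ padicValInt q₁ W.minimalDiscriminantInt ∧
      W.HasSplitMultiplicativeReductionAtPrime q₂ ∧ p ∣ padicValInt q₂ W.minimalDiscriminantInt ∧
      W.HasSplitMultiplicativeReductionAtPrime q₃ ∧ p ∣ padicValInt q₃ W.minimalDiscriminantInt
  · exact hC3 W p hX hp5 hsurj hnram htam h3 hnoI hnoD hnoU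
  · rcases inertDatum_or_upToOneDatum_of_not_threeOffending W p hp5 hX.2.2.1 hother h3 with hI | hU
    · exact absurd hI hnoI
    · exact absurd hU hnoU

end Summit.BirchSwinnertonDyer.BirchSwinnertonDyer.Theorems.EulerHalfInertUpToOne

end
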